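import Literature.AlgebraicGeometry.ShimuraVarieties.UnitaryBallSpecialDiscChart
import Literature.AlgebraicGeometry.ShimuraVarieties.UnitaryBallSpecialSourceFrame
import Literature.NumberTheory.Automorphic.UnitaryGroupFrameSubform
import HarnessLib

/-!
# The frame of a totally positive line: the sub-disc `𝔹(W^⊥)` in cone coordinates of `J⋆ = H|_{W^⊥}`

Topic `AlgebraicGeometry/ShimuraVarieties`; namespace
`Literature.AlgebraicGeometry.ShimuraVarieties.UnitaryBallUniformisationDatum`.  THEOREMS ONLY.  For a compact
ball-quotient datum `D : UnitaryBallUniformisationDatum 2 X`, a Sylvester frame `𝔣` and a FRAME of the hermitian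
space `(E³, H)` adapted to an orthogonal decomposition `V = V⋆ ⊕ W` — `B : GL₃(E)` with `ᵗσ(B)·H·B = J⋆ ⊕ᶠ J⊥`
(`formCongr`, `UnitaryGroup.finSum`; `W = E·(B e₃)`, `V⋆ = W^⊥ = B(E² ⊕ 0)`; the currency of
`UnitaryBallSpecialSourceFrame`) — we relate the special sub-ball `𝔹(W^⊥) = D.specialBall 𝔣 {B e₃}` of
`UnitaryBallSpecialCycleFinite` to the negative cone of the rank-2 form `J⋆`:

* §1 the complex embedding matrix `M = τ₁(B·(e₁|e₂)) : ℂ² → ℂ³` is an ISOMETRY `(ℂ², J⋆^{τ₁}) → (ℂ³, H^{τ₁})`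
  (`hermForm_embMatrix_mulVec`), injective, carries the negative cone of `J⋆^{τ₁}` into that of `H^{τ₁}`
  (`embMatrix_mulVec_mem_cone_iff`), lands in the orthogonal complement of `τ₁(B e₃)` (`pairE_lastCol_embMatrix_mulVec`)
  and EXHAUSTS it (`exists_embMatrix_mulVec_eq_of_pairE_eq_zero`);
* §2 consequently the ball chart of `M v`, `v ∈ negCone J⋆^{τ₁}`, lies on the sub-disc `𝔹(W^⊥)`
  (`coneChart_embMatrix_mem_specialBall`), and every point of the sub-disc arises this way
  (`exists_coneLift_eq_embMatrix_mulVec`);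
* §3 the last column `B e₃` is non-zero, spans a TOTALLY POSITIVE line when `Re τ(J⊥₀₀) > 0` at every `τ`
  (`isTotallyPositive_span_lastCol`), and the sub-disc is non-empty (`specialBall_lastCol_nonempty`, from a Sylvester
  frame of `J⋆^{τ₁}` of signature `(1,1)`, `exists_sylvesterFrame_subform`); `J⋆` is hermitian, anisotropic and
  positive definite off the distinguished place (`UnitaryGroupFrameSubform`).

These are the algebraic inputs of the `UnitaryBallUniformisationDatum 1` of a special curve
(`UnitaryBallSpecialCurveDatum`, road (ii) «embedded-curve descent» of the cell `hodgecm-mathlib`, census R2-2/R2-5).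
Everything is PROVED; no named facts, no definitions.

References: N. Bergeron, J. Millson, C. Moeglin, Acta Math. 216 (2016), Part 2 §§1.1, 3.1–3.3; S. Kudla, Compositio
Math. 51 (1984), §1; Y. Liu, Camb. J. Math. 9 (2021), proof of Thm. 4.15 (l. 2207).
HC_CM is proved only modulo the 7 printed citations until rung 0 closes; nothing here is in a registered cone.
-/

set_option autoImplicit false

noncomputable section

open scoped ComplexOrder
open Matrix Complex ComplexConjugate NumberField Set Function
open Literature.Geometry.ComplexHyperbolic
open Literature.Geometry.ComplexHyperbolic.BallModel
open Literature.NumberTheory.Automorphic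
open Literature.NumberTheory.Automorphic.UnitaryGroup (finSum)

namespace Literature.AlgebraicGeometry.ShimuraVarieties

namespace UnitaryBallUniformisationDatum

open Literature.AlgebraicGeometry.Motives (SchemeOver ComplexPoints)

variable {X : SchemeOver ℂ} (D : UnitaryBallUniformisationDatum 2 X) (𝔣 : D.SylvesterFrame)
variable (B : GL (Fin 3) D.E) (Jstar : Matrix (Fin 2) (Fin 2) D.E) (Jperp : Matrix (Fin 1) (Fin 1) D.E)

/-! ### §1 The complex embedding matrix `M = τ₁(B·(e₁|e₂))` -/

/-- The frame equation with the unit scalar displayed: `ᵗσ(B)·((1 : E) • H)·B = J⋆ ⊕ᶠ J⊥` (the shape consumed by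
`UnitaryGroupFrameSubform` / `UnitaryGroupFrameEmbedding`). [cite: Kudla1984, §1] -/
theorem formCongr_one_smul_eq (hB : formCongr (conjRingHom D.E) B D.H = finSum 2 1 Jstar Jperp) :
    formCongr (conjRingHom D.E) B ((1 : D.E) • D.H) = finSum 2 1 Jstar Jperp := by
  rw [one_smul]; exact hB

/-- The embedding matrix is the first-summand block of `B^{τ₁}`: `M v = B^{τ₁}(v ⊕ 0)`. [cite: Kudla1984, §1] -/
theorem embMatrix_mulVec_eq_map_mulVec_append (v : Fin 2 → ℂ) :
    (((B : Matrix (Fin 3) (Fin 3) D.E).submatrix id Fin.castSucc).map D.E.subtype) *ᵥ v =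
      ((B : Matrix (Fin 3) (Fin 3) D.E).map D.E.subtype) *ᵥ Fin.append v (0 : Fin 1 → ℂ) := by
  rw [← submatrix_castSucc_mulVec]
  rfl

/-- **`M` is injective.** [cite: Kudla1984, §1] -/
theorem embMatrix_mulVec_injective :
    Injective fun v : Fin 2 → ℂ ↦
      (((B : Matrix (Fin 3) (Fin 3) D.E).submatrix id Fin.castSucc).map D.E.subtype) *ᵥ v := by
  intro v w h
  have h' : ((Matrix.GeneralLinearGroup.map D.E.subtype B : GL (Fin 3) ℂ) : Matrix (Fin 3) (Fin 3) ℂ) *ᵥ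
      Fin.append v (0 : Fin 1 → ℂ) =
      ((Matrix.GeneralLinearGroup.map D.E.subtype B : GL (Fin 3) ℂ) : Matrix (Fin 3) (Fin 3) ℂ) *ᵥ
      Fin.append w (0 : Fin 1 → ℂ) := by
    change ((B : Matrix (Fin 3) (Fin 3) D.E).map D.E.subtype) *ᵥ _ =
      ((B : Matrix (Fin 3) (Fin 3) D.E).map D.E.subtype) *ᵥ _
    rw [← embMatrix_mulVec_eq_map_mulVec_append, ← embMatrix_mulVec_eq_map_mulVec_append]
    exact h
  exact UnitaryGroup.frameEmb_injective (N₁ := 2) (N₂ := 1) (Matrix.GeneralLinearGroup.map D.E.subtype B) h'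

/-- **`M` is an isometry `(ℂ², J⋆^{τ₁}) → (ℂ³, H^{τ₁})`**: `⟨M v, M w⟩_{H^{τ₁}} = ⟨v, w⟩_{J⋆^{τ₁}}`.
[cite: BergeronMillsonMoeglin2016Balls, Part 2 §3.1] -/
theorem hermForm_embMatrix_mulVec (hB : formCongr (conjRingHom D.E) B D.H = finSum 2 1 Jstar Jperp)
    (v w : Fin 2 → ℂ) :
    hermForm (starRingEnd ℂ) D.Hℂ
        ((((B : Matrix (Fin 3) (Fin 3) D.E).submatrix id Fin.castSucc).map D.E.subtype) *ᵥ v)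
        ((((B : Matrix (Fin 3) (Fin 3) D.E).submatrix id Fin.castSucc).map D.E.subtype) *ᵥ w) =
      hermForm (starRingEnd ℂ) (Jstar.map D.E.subtype) v w := by
  have hgram := D.conjTranspose_embMatrix_mul_map_mul_embMatrix B Jstar Jperp hB
  set M := (((B : Matrix (Fin 3) (Fin 3) D.E).submatrix id Fin.castSucc).map D.E.subtype) with hM
  rw [hermForm_starRingEnd, hermForm_starRingEnd, star_mulVec, mulVec_mulVec, dotProduct_mulVec, vecMul_vecMul,
    ← Matrix.mul_assoc]
  change star v ᵥ* (Mᴴ * D.H.map D.E.subtype * M) ⬝ᵥ w = _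
  rw [hgram, ← dotProduct_mulVec]

/-- **`M` carries negative vectors to negative vectors, and only those**: `M v ∈ negCone H^{τ₁} ↔ v ∈ negCone J⋆^{τ₁}`.
[cite: BergeronMillsonMoeglin2016Balls, Part 2 §3.1] -/
theorem embMatrix_mulVec_mem_cone_iff (hB : formCongr (conjRingHom D.E) B D.H = finSum 2 1 Jstar Jperp)
    (v : Fin 2 → ℂ) :
    (((B : Matrix (Fin 3) (Fin 3) D.E).submatrix id Fin.castSucc).map D.E.subtype) *ᵥ v ∈ D.cone ↔
      v ∈ negCone (Jstar.map D.E.subtype) := by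
  change (hermForm (starRingEnd ℂ) D.Hℂ _ _).re < 0 ↔ (hermForm (starRingEnd ℂ) (Jstar.map D.E.subtype) v v).re < 0
  rw [D.hermForm_embMatrix_mulVec B Jstar Jperp hB]

/-- **`M(ℂ²)` is orthogonal to the last column `B e₃`**: `⟪τ₁(B e₃), M v⟫ = 0`.
[cite: BergeronMillsonMoeglin2016Balls, Part 2 §3.1] -/
theorem pairE_lastCol_embMatrix_mulVec (hB : formCongr (conjRingHom D.E) B D.H = finSum 2 1 Jstar Jperp)
    (v : Fin 2 → ℂ) :
    D.pairE (fun i => (B : Matrix (Fin 3) (Fin 3) D.E) i (Fin.last 2))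
      ((((B : Matrix (Fin 3) (Fin 3) D.E).submatrix id Fin.castSucc).map D.E.subtype) *ᵥ v) = 0 :=
  D.hermForm_map_span_lastCol_embMatrix_mulVec B Jstar Jperp hB _ (Submodule.mem_span_singleton_self _) v

/-- The last column of the frame in vector form: `B e₃ = B·(0 ⊕ 1)`. [cite: Kudla1984, §1] -/
theorem append_zero_one_eq_single {R : Type*} [Zero R] [One R] :
    Fin.append (0 : Fin 2 → R) (fun _ : Fin 1 => (1 : R)) = Pi.single (Fin.last 2) 1 := by
  funext k
  refine Fin.addCases (m := 2) (n := 1) (fun j => ?_) (fun j => ?_) k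
  · rw [Fin.append_left, Pi.zero_apply, Pi.single_eq_of_ne]
    exact Fin.ne_of_lt (Fin.castAdd_lt 1 j)
  · rw [Fin.append_right, Subsingleton.elim j 0]
    change (1 : R) = (Pi.single (Fin.last 2) (1 : R) : Fin 3 → R) (Fin.last 2)
    rw [Pi.single_eq_same]

/-- The last column of the frame in vector form: `B e₃ = B·(0 ⊕ 1)`. [cite: Kudla1984, §1] -/
theorem lastCol_eq_mulVec_append :
    (fun i => (B : Matrix (Fin 3) (Fin 3) D.E) i (Fin.last 2)) =
      (B : Matrix (Fin 3) (Fin 3) D.E) *ᵥ Fin.append (0 : Fin 2 → D.E) (fun _ : Fin 1 => 1) := by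
  rw [append_zero_one_eq_single, Matrix.mulVec_single_one]
  rfl

/-- **`M(ℂ²)` IS the orthogonal complement of `τ₁(B e₃)`** (when `J⊥₀₀ ≠ 0`): a complex vector orthogonal to the last
column is `M v` for a unique `v`. [cite: BergeronMillsonMoeglin2016Balls, Part 2 §3.1] -/
theorem exists_embMatrix_mulVec_eq_of_pairE_eq_zero (hB : formCongr (conjRingHom D.E) B D.H = finSum 2 1 Jstar Jperp)
    (hJ : (D.E.subtype (Jperp 0 0)) ≠ 0) {u : Fin 3 → ℂ}
    (hu : D.pairE (fun i => (B : Matrix (Fin 3) (Fin 3) D.E) i (Fin.last 2)) u = 0) :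
    ∃ v : Fin 2 → ℂ, (((B : Matrix (Fin 3) (Fin 3) D.E).submatrix id Fin.castSucc).map D.E.subtype) *ᵥ v = u := by
  -- write `u = B^τ w`
  set Bc : GL (Fin 3) ℂ := Matrix.GeneralLinearGroup.map D.E.subtype B with hBc
  have hBcval : (Bc : Matrix (Fin 3) (Fin 3) ℂ) = (B : Matrix (Fin 3) (Fin 3) D.E).map D.E.subtype := rfl
  set w : Fin 3 → ℂ := ((Bc⁻¹ : GL (Fin 3) ℂ) : Matrix (Fin 3) (Fin 3) ℂ) *ᵥ u with hw
  have huw : u = (Bc : Matrix (Fin 3) (Fin 3) ℂ) *ᵥ w := by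
    rw [hw, mulVec_mulVec, ← Units.val_mul, mul_inv_cancel, Units.val_one, one_mulVec]
  -- split `w = w₁ ⊕ w₂`
  set w₁ : Fin 2 → ℂ := fun j => w (Fin.castAdd 1 j) with hw₁
  set w₂ : Fin 1 → ℂ := fun k => w (Fin.natAdd 2 k) with hw₂
  have hsplit : Fin.append w₁ w₂ = w := by
    funext i
    refine Fin.addCases (fun j => ?_) (fun k => ?_) i
    · rw [Fin.append_left]
    · rw [Fin.append_right]
  -- the pairing with the last column reads `J⊥₀₀^τ · w₂ 0`
  have hτ : ∀ x, D.E.subtype (conjRingHom D.E x) = starRingEnd ℂ (D.E.subtype x) := embedding_conjRingHom D.E D.E.subtype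
  have hkey := UnitaryGroup.mul_hermForm_map_frameEmb_eq (N₁ := 2) (N₂ := 1) (σ := conjRingHom D.E) D.E.subtype hτ
    (D.formCongr_one_smul_eq B Jstar Jperp hB) (0 : Fin 2 → ℂ) w₁ (fun _ => 1) w₂
  rw [map_one, one_mul, hsplit] at hkey
  have hcol : (D.τ₁ ∘ fun i => (B : Matrix (Fin 3) (Fin 3) D.E) i (Fin.last 2)) =
      ((B : Matrix (Fin 3) (Fin 3) D.E).map D.E.subtype) *ᵥ Fin.append (0 : Fin 2 → ℂ) (fun _ : Fin 1 => (1 : ℂ)) := by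
    rw [D.lastCol_eq_mulVec_append B]
    funext i
    rw [Function.comp_apply, RingHom.map_mulVec]
    congr 1
    rw [append_zero_one_eq_single, append_zero_one_eq_single]
    funext k
    rw [Function.comp_apply]
    by_cases hk : k = Fin.last 2
    · subst hk
      rw [Pi.single_eq_same, Pi.single_eq_same, map_one]
    · rw [Pi.single_eq_of_ne hk, Pi.single_eq_of_ne hk, map_zero]
  have hpair : D.pairE (fun i => (B : Matrix (Fin 3) (Fin 3) D.E) i (Fin.last 2)) u =
      hermForm (starRingEnd ℂ) (Jstar.map D.E.subtype) 0 w₁ +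
        hermForm (starRingEnd ℂ) (Jperp.map D.E.subtype) (fun _ => 1) w₂ := by
    rw [pairE, hcol, huw, hBcval]
    exact hkey
  have h0 : hermForm (starRingEnd ℂ) (Jstar.map D.E.subtype) (0 : Fin 2 → ℂ) w₁ = 0 := by
    simp [hermForm_starRingEnd]
  have h1 : hermForm (starRingEnd ℂ) (Jperp.map D.E.subtype) (fun _ => (1 : ℂ)) w₂ =
      D.E.subtype (Jperp 0 0) * w₂ 0 := by
    simp [hermForm_starRingEnd, dotProduct, Matrix.mulVec]
  rw [hu, h0, zero_add, h1] at hpair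
  have hw₂0 : w₂ 0 = 0 := by
    rcases mul_eq_zero.1 hpair.symm with h | h
    · exact (hJ h).elim
    · exact h
  have hw₂ : w₂ = 0 := by
    funext k
    rw [Subsingleton.elim k 0, hw₂0, Pi.zero_apply]
  refine ⟨w₁, ?_⟩
  rw [embMatrix_mulVec_eq_map_mulVec_append, huw, hBcval, ← hsplit, hw₂]

/-! ### §2 The sub-disc `𝔹(W^⊥)` through `M` -/

/-- The lift of the chart of a cone vector is a non-zero multiple of it. [cite: BergeronMillsonMoeglin2016Balls, Part 2 §1.3] -/
theorem exists_coneLift_coneChart_eq_smul (u : D.cone) :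
    ∃ c : ℂ, c ≠ 0 ∧ ((D.coneLift 𝔣 (D.coneChart 𝔣 u) : D.cone) : Fin 3 → ℂ) = c • (u : Fin 3 → ℂ) :=
  (D.coneChart_eq_iff 𝔣 _ _).1 (D.coneChart_coneLift 𝔣 _)

/-- **The ball chart of `M v` lies on the sub-disc `𝔹(W^⊥)`**, `W = E·(B e₃)`, for every `v ∈ negCone J⋆^{τ₁}`.
[cite: BergeronMillsonMoeglin2016Balls, Part 2 §3.3] -/
theorem coneChart_embMatrix_mem_specialBall (hB : formCongr (conjRingHom D.E) B D.H = finSum 2 1 Jstar Jperp)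
    {v : Fin 2 → ℂ} (hv : v ∈ negCone (Jstar.map D.E.subtype)) :
    D.coneChart 𝔣 ⟨(((B : Matrix (Fin 3) (Fin 3) D.E).submatrix id Fin.castSucc).map D.E.subtype) *ᵥ v,
        (D.embMatrix_mulVec_mem_cone_iff B Jstar Jperp hB v).2 hv⟩ ∈
      D.specialBall 𝔣 {fun i => (B : Matrix (Fin 3) (Fin 3) D.E) i (Fin.last 2)} := by
  rw [mem_specialBall_iff]
  intro s hs
  rw [Set.mem_singleton_iff.1 hs]
  obtain ⟨c, -, hc⟩ := D.exists_coneLift_coneChart_eq_smul 𝔣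
    ⟨(((B : Matrix (Fin 3) (Fin 3) D.E).submatrix id Fin.castSucc).map D.E.subtype) *ᵥ v,
      (D.embMatrix_mulVec_mem_cone_iff B Jstar Jperp hB v).2 hv⟩
  rw [hc, pairE_smul_right, D.pairE_lastCol_embMatrix_mulVec B Jstar Jperp hB, mul_zero]

/-- **Every point of the sub-disc comes from the cone of `J⋆`**: for `z ∈ 𝔹(W^⊥)` the cone lift `T(z,1)` is `M v` for some
`v ∈ negCone J⋆^{τ₁}` (when `J⊥₀₀ ≠ 0`). [cite: BergeronMillsonMoeglin2016Balls, Part 2 §3.3] -/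
theorem exists_coneLift_eq_embMatrix_mulVec (hB : formCongr (conjRingHom D.E) B D.H = finSum 2 1 Jstar Jperp)
    (hJ : (D.E.subtype (Jperp 0 0)) ≠ 0) {z : Ball}
    (hz : z ∈ D.specialBall 𝔣 {fun i => (B : Matrix (Fin 3) (Fin 3) D.E) i (Fin.last 2)}) :
    ∃ v : Fin 2 → ℂ, v ∈ negCone (Jstar.map D.E.subtype) ∧
      (((B : Matrix (Fin 3) (Fin 3) D.E).submatrix id Fin.castSucc).map D.E.subtype) *ᵥ v =
        ((D.coneLift 𝔣 z : D.cone) : Fin 3 → ℂ) := by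
  have h0 := (D.mem_specialBall_iff 𝔣).1 hz _ (Set.mem_singleton _)
  obtain ⟨v, hv⟩ := D.exists_embMatrix_mulVec_eq_of_pairE_eq_zero B Jstar Jperp hB hJ h0
  refine ⟨v, ?_, hv⟩
  rw [← D.embMatrix_mulVec_mem_cone_iff B Jstar Jperp hB v, hv]
  exact (D.coneLift 𝔣 z).2

/-! ### §3 The line `W = E·(B e₃)` and the form `J⋆` -/

/-- The last column of an invertible matrix is non-zero. [cite: Kudla1984, §1] -/
theorem lastCol_ne_zero : (fun i => (B : Matrix (Fin 3) (Fin 3) D.E) i (Fin.last 2)) ≠ 0 := by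
  intro h
  have hdet : (B : Matrix (Fin 3) (Fin 3) D.E).det = 0 :=
    Matrix.det_eq_zero_of_column_eq_zero (Fin.last 2) fun i => congrFun h i
  exact (Matrix.GeneralLinearGroup.det_ne_zero B) hdet

/-- `⟨B e₃, B e₃⟩_H = J⊥₀₀`. [cite: Kudla1984, §1] -/
theorem hermForm_lastCol_lastCol (hB : formCongr (conjRingHom D.E) B D.H = finSum 2 1 Jstar Jperp) :
    hermForm (conjRingHom D.E) D.H (fun i => (B : Matrix (Fin 3) (Fin 3) D.E) i (Fin.last 2))
      (fun i => (B : Matrix (Fin 3) (Fin 3) D.E) i (Fin.last 2)) = Jperp 0 0 := by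
  rw [← formCongr_apply_eq_hermForm, hB]
  exact UnitaryGroup.finSum_apply_natAdd_natAdd (N₁ := 2) (N₂ := 1) (J₁ := Jstar) (J₂ := Jperp) 0 0

/-- **The line `W = E·(B e₃)` is totally positive definite** when `Re τ(J⊥₀₀) > 0` at every complex embedding `τ`.
[cite: BergeronMillsonMoeglin2016Balls, Introduction §1.7] -/
theorem isTotallyPositive_span_lastCol (hB : formCongr (conjRingHom D.E) B D.H = finSum 2 1 Jstar Jperp)
    (hpos : ∀ τ : D.E →+* ℂ, 0 < (τ (Jperp 0 0)).re) :
    IsTotallyPositive (conjRingHom D.E) D.H (D.E ∙ fun i => (B : Matrix (Fin 3) (Fin 3) D.E) i (Fin.last 2)) := by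
  intro w hw hw0 τ
  obtain ⟨c, rfl⟩ := Submodule.mem_span_singleton.1 hw
  have hc : c ≠ 0 := by
    rintro rfl
    exact hw0 (zero_smul _ _)
  set s := fun i => (B : Matrix (Fin 3) (Fin 3) D.E) i (Fin.last 2) with hs
  have hform : hermForm (conjRingHom D.E) D.H (c • s) (c • s) = conjRingHom D.E c * c * Jperp 0 0 := by
    rw [← D.hermForm_lastCol_lastCol B Jstar Jperp hB]
    simp only [hermForm, Matrix.mulVec_smul, dotProduct_smul, smul_eq_mul]
    have : (⇑(conjRingHom D.E) ∘ (c • s)) = conjRingHom D.E c • (⇑(conjRingHom D.E) ∘ s) := by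
      funext i; simp [Pi.smul_apply, smul_eq_mul]
    rw [this, smul_dotProduct, smul_eq_mul]
    ring
  rw [hform, map_mul, map_mul, embedding_conjRingHom D.E τ, ← Complex.normSq_eq_conj_mul_self, Complex.re_ofReal_mul]
  exact mul_pos (Complex.normSq_pos.2 ((map_ne_zero τ).2 hc)) (hpos τ)

/-- `J⋆` is hermitian: `σ(J⋆ᵢⱼ) = J⋆ⱼᵢ`. [cite: BergeronMillsonMoeglin2016Balls, Part 2 §1.1] -/
theorem conj_subform_apply (hB : formCongr (conjRingHom D.E) B D.H = finSum 2 1 Jstar Jperp) (i j : Fin 2) :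
    conjRingHom D.E (Jstar i j) = Jstar j i := by
  have hH : (D.H.map (conjRingHom D.E))ᵀ = D.H := Matrix.ext fun a b => by
    rw [transpose_apply, Matrix.map_apply]; exact D.conj_H_apply b a
  have h := UnitaryGroup.isHermitian_subform_left (N₁ := 2) (N₂ := 1) (conjRingHom D.E)
    (fun x => by simp [conjRingHom_apply]) hH (map_one _) (D.formCongr_one_smul_eq B Jstar Jperp hB)
  have hij := congrFun (congrFun h j) i
  rwa [transpose_apply, Matrix.map_apply] at hij

/-- `J⋆` is anisotropic. [cite: BergeronMillsonMoeglin2016Balls, Part 2 §1.1] -/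
theorem anisotropic_subform (hB : formCongr (conjRingHom D.E) B D.H = finSum 2 1 Jstar Jperp)
    (v : Fin 2 → D.E) (hv : hermForm (conjRingHom D.E) Jstar v v = 0) : v = 0 :=
  UnitaryGroup.anisotropic_subform_left (N₁ := 2) (N₂ := 1) (σ := conjRingHom D.E) D.anisotropic one_ne_zero
    (D.formCongr_one_smul_eq B Jstar Jperp hB) v hv

/-- `J⋆` is positive definite at every complex embedding off the distinguished place.
[cite: BergeronMillsonMoeglin2016Balls, Part 2 §1.1] -/
theorem posDef_map_subform (hB : formCongr (conjRingHom D.E) B D.H = finSum 2 1 Jstar Jperp)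
    (τ : D.E →+* ℂ) (hτ : InfinitePlace.mk τ ≠ InfinitePlace.mk D.E.subtype) : (Jstar.map τ).PosDef := by
  have hJ₁ : (Jstar.map (conjRingHom D.E))ᵀ = Jstar := Matrix.ext fun i j => by
    rw [transpose_apply, Matrix.map_apply]; exact D.conj_subform_apply B Jstar Jperp hB j i
  exact UnitaryGroup.posDef_map_subform_left (N₁ := 2) (N₂ := 1) (σ := conjRingHom D.E) τ
    (embedding_conjRingHom D.E τ) (D.posDef_of_ne τ hτ) (by rw [map_one, Complex.one_re]; exact one_pos)
    (by rw [map_one, Complex.one_im]) hJ₁ (D.formCongr_one_smul_eq B Jstar Jperp hB)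

/-- `signatureMatrix 1 = diag(1,−1)`. [cite: BergeronMillsonMoeglin2016Balls, Part 2 §1.1] -/
theorem signatureMatrix_one : signatureMatrix 1 = Matrix.diagonal ![(1 : ℂ), -1] := by
  unfold signatureMatrix
  congr 1
  funext i
  fin_cases i <;> simp [Fin.last]

include 𝔣 in
/-- **`J⋆^{τ₁}` has signature `(1,1)`**: a Sylvester frame `ᵗT̄⋆·J⋆^{τ₁}·T⋆ = diag(1,−1)` exists (from the datum's frame of
`H^{τ₁}` and `Re τ₁(J⊥₀₀) > 0`). [cite: HornJohnson2013, §4.5 Thm 4.5.8 (Sylvester's law of inertia)]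
[cite: BergeronMillsonMoeglin2016Balls, Part 2 §3.1] -/
theorem exists_sylvesterFrame_subform (hB : formCongr (conjRingHom D.E) B D.H = finSum 2 1 Jstar Jperp)
    (hpos : 0 < (D.E.subtype (Jperp 0 0)).re) :
    ∃ Tstar : GL (Fin 2) ℂ,
      (Tstar : Matrix (Fin 2) (Fin 2) ℂ)ᴴ * Jstar.map D.E.subtype * (Tstar : Matrix (Fin 2) (Fin 2) ℂ) =
        signatureMatrix 1 := by
  have hH : (D.H.map (conjRingHom D.E))ᵀ = D.H := Matrix.ext fun a b => by
    rw [transpose_apply, Matrix.map_apply]; exact D.conj_H_apply b a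
  have hT : formCongr (starRingEnd ℂ) 𝔣.T (D.H.map D.E.subtype) = Matrix.diagonal ![1, 1, -1] := by
    rw [show Matrix.diagonal ![(1 : ℂ), 1, -1] = BallModel.J from rfl, ← 𝔣.conjTranspose_mul_mul]
    simp only [formCongr, Matrix.conjTranspose, Matrix.transpose_map]
    rfl
  obtain ⟨Tstar, hTstar⟩ := UnitaryGroup.exists_frame_map_subform_left_eq_diagonal_one (σ := conjRingHom D.E)
    (τ := D.E.subtype) (fun x => by simp [conjRingHom_apply]) (embedding_conjRingHom D.E D.E.subtype) hH hT
    (D.formCongr_one_smul_eq B Jstar Jperp hB) hpos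
  refine ⟨Tstar, ?_⟩
  rw [signatureMatrix_one, ← hTstar]
  simp only [formCongr, Matrix.conjTranspose, Matrix.transpose_map]
  rfl

/-- **The sub-disc is non-empty**: the chart of `M (T⋆ e₂)` (a negative vector of `J⋆^{τ₁}`) lies on `𝔹(W^⊥)`.
[cite: BergeronMillsonMoeglin2016Balls, Part 2 §3.3] -/
theorem specialBall_lastCol_nonempty (hB : formCongr (conjRingHom D.E) B D.H = finSum 2 1 Jstar Jperp)
    (hpos : 0 < (D.E.subtype (Jperp 0 0)).re) :
    (D.specialBall 𝔣 {fun i => (B : Matrix (Fin 3) (Fin 3) D.E) i (Fin.last 2)}).Nonempty := by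
  obtain ⟨Tstar, hT⟩ := D.exists_sylvesterFrame_subform 𝔣 B Jstar Jperp hB hpos
  set v₀ : Fin 2 → ℂ := (Tstar : Matrix (Fin 2) (Fin 2) ℂ) *ᵥ ![0, 1] with hv₀
  have hneg : v₀ ∈ negCone (Jstar.map D.E.subtype) := by
    rw [mem_negCone_iff, hv₀, star_mulVec, mulVec_mulVec, dotProduct_mulVec, vecMul_vecMul, ← Matrix.mul_assoc, hT,
      signatureMatrix_one]
    simp [dotProduct, Fin.sum_univ_two, Matrix.diagonal, vecMul]
  exact ⟨_, D.coneChart_embMatrix_mem_specialBall 𝔣 B Jstar Jperp hB hneg⟩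

/-- **The last column packaged as a `DiscVec`** (`𝔹(W^⊥) ≠ ∅` and `B e₃ ≠ 0`), the input of `specialDisc`/`specialCurve`.
[cite: BergeronMillsonMoeglin2016Balls, Part 2 §3.3] -/
theorem lastCol_discVec (hB : formCongr (conjRingHom D.E) B D.H = finSum 2 1 Jstar Jperp)
    (hpos : 0 < (D.E.subtype (Jperp 0 0)).re) :
    (D.specialBall 𝔣 {fun i => (B : Matrix (Fin 3) (Fin 3) D.E) i (Fin.last 2)}).Nonempty ∧
      (fun i => (B : Matrix (Fin 3) (Fin 3) D.E) i (Fin.last 2)) ≠ 0 :=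
  ⟨D.specialBall_lastCol_nonempty 𝔣 B Jstar Jperp hB hpos, D.lastCol_ne_zero B⟩

end UnitaryBallUniformisationDatum

end Literature.AlgebraicGeometry.ShimuraVarieties

end
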